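import Summits.KontsevichZagierPeriods.KontsevichZagierPeriods.Theorems.RealOnePeriodRelations.Negative.GreenSound

/-!
# `RealOnePeriodRelations` (stmt-KontsevichZagierPeriods-10042) — negative side II′: the hypothesis `eval c = 0` is load-bearing

`realOnePeriodRelations_false_without_eval`: with `eval c = 0` dropped the statement is FALSE — witness
`[∫₀¹ 1] ∈ H₁` of value `1` against the soundness `M₁ ≤ ker eval` (`Negative/GreenSound`). Together with
`Negative/Grading` (`c ∈ H₁` is load-bearing): ANY proof of the crux uses both hypotheses.
[Kontsevich–Zagier 2001, §1.2]
-/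

noncomputable section

open scoped BigOperators Topology
open Set MeasureTheory Filter
open Literature.NumberTheory.Transcendental

namespace Summit.KontsevichZagierPeriods.SymplecticScissors.RealOnePeriodRelationsNegative

/-! ### §3.2 Dropping `eval c = 0` -/

/-- The crux WITHOUT the hypothesis `eval c = 0` (a refuter-posited deletion variant for the
load-bearing test, not a statement from the literature): every 1-dimensional combination lies in
`M₁`. -/
def RealOnePeriodRelationsWithoutEval : Prop :=
  ∀ c : KZ.FormalRep, c ∈ H₁ → c ∈ M₁

/-- **`eval c = 0` is load-bearing**: without it the statement is false — `[∫₀¹ 1] ∈ H₁` has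
value `1`, while `M₁` is sound (`M₁_le_ker_eval`). Any proof of the crux must use `eval c = 0`.
[cite: KontsevichZagier2001, §1.2] -/
theorem realOnePeriodRelations_false_without_eval : ¬ RealOnePeriodRelationsWithoutEval := by
  intro h
  have hmem : KZ.of (constRep₁ 1) ∈ H₁ := AddSubgroup.subset_closure ⟨constRep₁ 1, rfl⟩
  have h0 := eval_eq_zero_of_mem_M₁ (h _ hmem)
  rw [KZ.eval_of, value_constRep₁] at h0
  norm_num at h0

end Summit.KontsevichZagierPeriods.SymplecticScissors.RealOnePeriodRelationsNegative

end
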